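import Summits.AtomisticToContinuum.HydrodynamicLimit.Theorems.AntiMazurCoboundariesCorrectorPressureDecayKiferCanonicalBlowUpIntensity
import Summits.AtomisticToContinuum.HydrodynamicLimit.Theorems.AntiMazurCoboundariesCorrectorPressureDecayKiferVagueLimitIntensity
import Summits.AtomisticToContinuum.HydrodynamicLimit.Theorems.AntiMazurCoboundariesCorrectorPressureDecayKiferCanonicalBlowUpDomination
import Summits.AtomisticToContinuum.HydrodynamicLimit.Theorems.AntiMazurCoboundariesCorrectorPressureDecayKiferSetwiseUpgrade
import Summits.AtomisticToContinuum.HydrodynamicLimit.Theorems.AntiMazurCoboundariesCorrectorPressureDecayTangentTightnessClosed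

/-!
# The canonical local limit, VI: setwise local limits of the blown-up canonical laws EXIST (line `FirstLemma`, crux stmt-AtomisticToContinuum-14135)

Registered stub `stub_canonicalLocalLimitExists` of skeleton v10 of line `FirstLemma` (idea `kifer-compactification`),
namespace `Summit.AtomisticToContinuum.HydrodynamicLimit.Theorems.KiferCompactification` — the compactness half (E1') of
the decomposition of Georgii's named fact `Georgii1995_hardSphereCanonicalLocalLimit` (…KiferCanonicalLocalLimit.lean p151154,
…Closure.lean p152644: E1 ⟸ E1'), ASSEMBLED from its four landed sub-stubs (lead c8, wave 1):

* `stub_canonicalBlowUpIntensity` (p155148): intensity of the x-averaged blow-ups `≤ σ³ · Leb`;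
* `stub_canonicalBlowUpWindowDomination`: one finite majorant of the window laws on each centred box, uniformly in `N`;
* `stub_intensity_of_laplaceLimit` (p155470): Laplace-functional limits inherit intensity bounds;
* `stub_setwiseWindowLimit_of_domination`: Laplace convergence + domination + Lebesgue-continuous intensities ⇒ setwise
  convergence of all bounded window laws;

together with the DISCHARGED Kallenberg compactness of hard-core laws `hardCoreLawsVaguelyCompact_holds` (p144923):
take a vague cluster point `μ` of the (probability, unit-hard-core) laws `canonicalBlowUpLaw σ a θ u₀ (N k) (Φ k)` along `κ`;
its intensity is `≤ σ³ Leb`; along `κ` the window laws are dominated, so they converge setwise to those of `μ`.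
Consequences recorded: `canonicalBlowUpLocallyCompact_holds : CanonicalBlowUpLocallyCompact` (E1) and
`georgii1995_hardSphereCanonicalLocalLimit_of_isGibbs : CanonicalLocalLimitIsGibbs → Georgii1995_hardSphereCanonicalLocalLimit`
(the named fact now rests on its identification half (E2) alone).
-/

noncomputable section

open MeasureTheory Set Filter Topology
open scoped ENNReal NNReal

namespace Summit.AtomisticToContinuum.HydrodynamicLimit.Theorems.KiferCompactification

open Literature.MathematicalPhysics.KineticTheory (T3 V3 hsDiameter localGibbsLaw blowUp
  Georgii1995_hardSphereCanonicalLocalLimit)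
open Literature.MathematicalPhysics.KineticTheory.PointProcess (laplaceFunctional windowLaw centredBox
  HardCoreLawsVaguelyCompact)
open Literature.Analysis.FluidPDE (HardSphereFlow IsHardCore)
open Literature.Analysis.FunctionSpaces (PointConfig)

/-- **Setwise local limits of the blown-up canonical laws exist along subsequences** (registered stub
`stub_canonicalLocalLimitExists` = the hypothesis of `canonicalBlowUpLocallyCompact_of_exists_localLimit`, p152644), from
the four compactness sub-stubs and the discharged Kallenberg compactness of hard-core laws. -/
theorem stub_canonicalLocalLimitExists : ∀ (σ a θ : ℝ) (u₀ : V3), 0 < σ → σ ≤ 1 / 2 → 0 < a → 0 < θ →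
    ∀ (N : ℕ → ℕ)
      (Φ : ∀ k, HardSphereFlow (Literature.Analysis.FluidPDE.Torus.geometry (Fin 3)) (hsDiameter σ (N k)) (N k + 1)),
      Tendsto N atTop atTop →
      ∃ κ : ℕ → ℕ, StrictMono κ ∧ ∃ G : Measure (PointConfig (V3 × V3)), IsProbabilityMeasure G ∧
        IsCanonicalLocalLimit σ a θ u₀ (fun j => N (κ j)) (fun j => Φ (κ j)) G := by
  intro σ a θ u₀ hσ hσ2 ha hθ N Φ _hN
  set P : ℕ → Measure (PointConfig (V3 × V3)) := fun k => canonicalBlowUpLaw σ a θ u₀ (N k) (Φ k) with hP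
  have hPprob : ∀ k, IsProbabilityMeasure (P k) := fun k =>
    isProbabilityMeasure_canonicalBlowUp u₀ hσ2 ha hθ (N k) (Φ k)
  have hPhc : ∀ k, ∀ᵐ ω ∂(P k), IsHardCore 1 ω := fun k => ae_isHardCore_canonicalBlowUp hσ a θ u₀ (N k) (Φ k)
  obtain ⟨μ, hμP, -, κ, hκ, hconv⟩ := hardCoreLawsVaguelyCompact_holds (Fin 3) 1 one_pos P hPprob hPhc
  have hPprob' : ∀ k, IsProbabilityMeasure (P (κ k)) := fun k => hPprob _
  have hint : ∀ (k : ℕ) (B : Set V3), MeasurableSet B →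
      ∫⁻ ω, ((ω.count (Prod.fst ⁻¹' B) : ℕ∞) : ℝ≥0∞) ∂(P (κ k)) ≤ ENNReal.ofReal (σ ^ 3) * volume B :=
    fun k B hB => stub_canonicalBlowUpIntensity σ a θ u₀ hσ hσ2 ha hθ (N (κ k)) (Φ (κ k)) B hB
  have hμint := stub_intensity_of_laplaceLimit (fun k => P (κ k)) μ (ENNReal.ofReal (σ ^ 3)) hPprob' hμP
    ENNReal.ofReal_ne_top hconv hint
  have hdom : ∀ n : ℕ, ∃ R : Measure (PointConfig (V3 × V3)), IsFiniteMeasure R ∧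
      ∀ k, windowLaw (centredBox n) (P (κ k)) ≤ R := fun n => by
    obtain ⟨R, hR, h⟩ := stub_canonicalBlowUpWindowDomination σ a θ u₀ hσ hσ2 ha hθ n
    exact ⟨R, hR, fun k => h (N (κ k)) (Φ (κ k))⟩
  refine ⟨κ, hκ, μ, hμP, fun Λ hΛ hΛb A hA => ?_⟩
  exact stub_setwiseWindowLimit_of_domination (fun k => P (κ k)) μ (ENNReal.ofReal (σ ^ 3)) hPprob' hμP
    ENNReal.ofReal_ne_top hconv hint hμint hdom Λ hΛ hΛb A hA

/-- **(E1) holds**: local compactness of the blown-up canonical laws, with translation invariance, hard core and density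
of the limit (`canonicalBlowUpLocallyCompact_of_exists_localLimit`, p152644). -/
theorem canonicalBlowUpLocallyCompact_holds : CanonicalBlowUpLocallyCompact :=
  canonicalBlowUpLocallyCompact_of_exists_localLimit stub_canonicalLocalLimitExists

/-- **Georgii's named fact now rests on its identification half alone**: `CanonicalLocalLimitIsGibbs` (E2, Georgii 1995
Thm 3.4) implies `Georgii1995_hardSphereCanonicalLocalLimit`. -/
theorem georgii1995_hardSphereCanonicalLocalLimit_of_isGibbs (hE2 : CanonicalLocalLimitIsGibbs) :
    Georgii1995_hardSphereCanonicalLocalLimit :=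
  georgii1995_hardSphereCanonicalLocalLimit_of canonicalBlowUpLocallyCompact_holds hE2

end Summit.AtomisticToContinuum.HydrodynamicLimit.Theorems.KiferCompactification

end
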